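import Mathlib
import Summits.Ventures.PercRepro2.Defs
import Summits.Ventures.PercRepro2.Graph
import Summits.Ventures.PercRepro2.Events
import Summits.Ventures.PercRepro2.CycleDefs
import Summits.Ventures.PercRepro2.CycleTerm
import Summits.Ventures.PercRepro2.CycleDecode
import Summits.Ventures.PercRepro2.CycleHit

/-!
# The counting core with a set of hit vertices (blind cell PercRepro2, mine-a g47)

**Theorem `sum_wtA_nonneg`**: for a set `D` of positions of the cycle, a set `A` of hit vertices
with a witness `c ∈ A` strictly inside the hull of `D` (`min D < c ≤ max D`), and up-sets `𝓤 𝓥`,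

  `Σ_{τ ⊆ D} 1[A ⊆ arc τ] · (1[arc τ ∈ 𝓤] − 1[arc (D∖τ) ∈ 𝓤]) · (1[arc τ ∈ 𝓥] − 1[arc (D∖τ) ∈ 𝓥]) ≥ 0`

— the antipodal base case of (T_A) on the cycle (MINE-A.md §102, proofs/MINEA-CYCLE.md, corollary
(a)).  The proof is that of `CycleCore.sum_wt_nonneg` with the map `phi` of `CycleTerm` and the
decoder `psi D c` of `CycleDecode` at the witness cut `c`: the hit predicate passes from a
negative colouring to its image because the image arc contains the red arc (`arc τ ⊆ arc (phi τ)`),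
and it holds on the singleton images (their arc is everything).  No instance, no notation.
-/

namespace Summit.Ventures.PercRepro2

namespace TCycle

open Finset

variable {n : ℕ}

/-- The negative colourings for the hit set `A`. -/
noncomputable def negSetA (D A : Finset (Fin (n + 1))) (𝓤 𝓥 : Set (Set (Fin (n + 1)))) :
    Finset (Finset (Fin (n + 1))) :=
  D.powerset.filter fun τ => wtA D A 𝓤 𝓥 τ = -1

/-- The positive colourings for the hit set `A`. -/
noncomputable def posSetA (D A : Finset (Fin (n + 1))) (𝓤 𝓥 : Set (Set (Fin (n + 1)))) :
    Finset (Finset (Fin (n + 1))) :=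
  D.powerset.filter fun τ => wtA D A 𝓤 𝓥 τ = 1

/-- The antipodal sum is the number of positive colourings minus the number of negative ones. -/
lemma sum_wtA_eq_card_sub_card (D A : Finset (Fin (n + 1))) (𝓤 𝓥 : Set (Set (Fin (n + 1)))) :
    ∑ τ ∈ D.powerset, wtA D A 𝓤 𝓥 τ =
      ((posSetA D A 𝓤 𝓥).card : ℤ) - (negSetA D A 𝓤 𝓥).card := by
  unfold posSetA negSetA
  rw [card_filter, card_filter]
  push_cast
  rw [← sum_sub_distrib]
  refine sum_congr rfl fun τ _ => ?_
  rcases wtA_mem D A 𝓤 𝓥 τ with hw | hw | hw <;> rw [hw] <;> norm_num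

section Main

variable {D A : Finset (Fin (n + 1))} (hD : D.Nonempty) {𝓤 𝓥 : Set (Set (Fin (n + 1)))}

/-- **Red at the minimum**: the image is positive and decodes back (witness cut `c`). -/
lemma phi_spec_minA (hU : IsUpperSet 𝓤) (hV : IsUpperSet 𝓥) {c : Fin (n + 1)} (hcA : c ∈ A)
    (hc0 : D.min' hD < c) {τ : Finset (Fin (n + 1))} (hτ : τ ⊆ D) (h0 : D.min' hD ∈ τ)
    (h1 : D.max' hD ∉ τ) (hw : wtA D A 𝓤 𝓥 τ = -1) :
    phi D hD τ ⊆ D ∧ wtA D A 𝓤 𝓥 (phi D hD τ) = 1 ∧ psi D c (phi D hD τ) = τ := by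
  obtain ⟨hlh, h0l, hl1, h0f, hWU, hWV⟩ := neg_min_specA hD hU hV hcA hc0 hτ h0 h1 hw
  obtain ⟨hDU, hDV, hunivU, hunivV⟩ := arc_D_notMem_of_negA hU hV hτ hw
  obtain ⟨hhit, -⟩ := of_wtA_eq_neg_one hw
  set l := τ.max' ⟨_, h0⟩ with hl
  set f := (D \ τ).min' ⟨_, mem_sdiff.2 ⟨D.max'_mem hD, h1⟩⟩ with hf
  have hlτ : l ∈ τ := τ.max'_mem _
  have hmax : ∀ x ∈ τ, x ≤ l := fun x hx => τ.le_max' x hx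
  have hfD : f ∈ D \ τ := (D \ τ).min'_mem _
  have hfτ : f ∉ τ := (mem_sdiff.1 hfD).2
  have hfmin : ∀ x ∈ D \ τ, f ≤ x := fun x hx => (D \ τ).min'_le x hx
  have harc : arc τ = {v | v ≤ D.min' hD ∨ l < v} := arc_of_min_mem D hD hτ h0
  rw [phi_eq_of_min D hD h0 h1]
  by_cases hfl : f < l
  · rw [if_pos hfl]
    have hsub : flipLow τ f ⊆ D := flipLow_subset D hτ (mem_sdiff.1 hfD).1
    have h0' : D.min' hD ∉ flipLow τ f := by
      rw [mem_flipLow]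
      rintro (heq | ⟨_, hlt⟩)
      · exact absurd heq h0f.ne
      · exact absurd hlt (not_lt.2 h0f.le)
    have h1' : D.max' hD ∉ flipLow τ f := by
      rw [mem_flipLow]
      rintro (heq | ⟨hmem, _⟩)
      · exact absurd (heq ▸ lt_trans hfl hl1) (lt_irrefl _)
      · exact h1 hmem
    have harcI : arc (flipLow τ f) = {v | v ≤ f ∨ l < v} := arc_flipLow hlτ hmax hfl
    have harcI' : arc (D \ flipLow τ f) = arc D := arc_sdiff_of_neither D hD h0' h1'
    have hincl : arc τ ⊆ arc (flipLow τ f) := by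
      rw [harc, harcI]
      rintro v (hv | hv)
      · exact Or.inl (le_trans hv h0f.le)
      · exact Or.inr hv
    refine ⟨hsub, ?_, ?_⟩
    · apply wtA_eq_one_of
      · exact hitA_mono hincl hhit
      · rw [harcI]; exact hWU
      · rw [harcI]; exact hWV
      · rw [harcI']; exact hDU
      · rw [harcI']; exact hDV
    · have hne : (flipLow τ f).Nonempty := ⟨f, mem_flipLow.2 (Or.inl rfl)⟩
      have hmin' := min'_flipLow (τ := τ) (f := f) hne
      have hmax' := max'_flipLow hlτ hmax hfl hne
      rw [psi_of_ne D c hne (by rw [hmin', hmax']; exact hfl.ne), if_pos (by rw [hmax']; exact hlh),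
        hmin']
      ext x
      simp only [mem_union, mem_sdiff, mem_flipLow, mem_singleton, mem_filter]
      constructor
      · rintro (⟨hx | ⟨hx, _⟩, hne'⟩ | ⟨hxD, hxf⟩)
        · exact absurd hx hne'
        · exact hx
        · by_contra hxτ
          exact absurd (hfmin x (mem_sdiff.2 ⟨hxD, hxτ⟩)) (not_le.2 hxf)
      · intro hx
        have hxf : x ≠ f := fun heq => hfτ (heq ▸ hx)
        rcases lt_or_gt_of_ne hxf with hlt | hgt
        · exact Or.inr ⟨hτ hx, hlt⟩
        · exact Or.inl ⟨Or.inr ⟨hx, hgt⟩, hxf⟩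
  · rw [if_neg hfl]
    have hlf : l < f := lt_of_le_of_ne (not_lt.1 hfl) fun heq => hfτ (heq ▸ hlτ)
    have hsub : ({l} : Finset (Fin (n + 1))) ⊆ D := singleton_subset_iff.2 (hτ hlτ)
    have h0' : D.min' hD ∉ ({l} : Finset (Fin (n + 1))) := by
      rw [mem_singleton]; exact h0l.ne
    have h1' : D.max' hD ∉ ({l} : Finset (Fin (n + 1))) := by
      rw [mem_singleton]; exact hl1.ne'
    have harcI' : arc (D \ {l}) = arc D := arc_sdiff_of_neither D hD h0' h1'
    refine ⟨hsub, ?_, ?_⟩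
    · apply wtA_eq_one_of
      · rw [arc_singleton]; exact hitA_univ A
      · rw [arc_singleton]; exact hunivU
      · rw [arc_singleton]; exact hunivV
      · rw [harcI']; exact hDU
      · rw [harcI']; exact hDV
    · rw [psi_singleton, if_pos hlh]
      ext x
      simp only [mem_filter]
      constructor
      · rintro ⟨hxD, hxl⟩
        by_contra hxτ
        exact absurd (le_trans (hfmin x (mem_sdiff.2 ⟨hxD, hxτ⟩)) hxl) (not_le.2 hlf)
      · intro hx
        exact ⟨hτ hx, hmax x hx⟩

/-- **Red at the maximum**: the image is positive and decodes back (witness cut `c`). -/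
lemma phi_spec_maxA (hU : IsUpperSet 𝓤) (hV : IsUpperSet 𝓥) {c : Fin (n + 1)} (hcA : c ∈ A)
    (hc1 : c ≤ D.max' hD) {τ : Finset (Fin (n + 1))} (hτ : τ ⊆ D) (h0 : D.min' hD ∉ τ)
    (h1 : D.max' hD ∈ τ) (hw : wtA D A 𝓤 𝓥 τ = -1) :
    phi D hD τ ⊆ D ∧ wtA D A 𝓤 𝓥 (phi D hD τ) = 1 ∧ psi D c (phi D hD τ) = τ := by
  obtain ⟨hhf, h0f, hf1, hl1, hWU, hWV⟩ := neg_max_specA hD hU hV hcA hc1 hτ h0 h1 hw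
  obtain ⟨hDU, hDV, hunivU, hunivV⟩ := arc_D_notMem_of_negA hU hV hτ hw
  obtain ⟨hhit, -⟩ := of_wtA_eq_neg_one hw
  set f := τ.min' ⟨_, h1⟩ with hf
  set l := (D \ τ).max' ⟨_, mem_sdiff.2 ⟨D.min'_mem hD, h0⟩⟩ with hl
  have hfτ : f ∈ τ := τ.min'_mem _
  have hmin : ∀ x ∈ τ, f ≤ x := fun x hx => τ.min'_le x hx
  have hlD : l ∈ D \ τ := (D \ τ).max'_mem _
  have hlτ : l ∉ τ := (mem_sdiff.1 hlD).2
  have hlmax : ∀ x ∈ D \ τ, x ≤ l := fun x hx => (D \ τ).le_max' x hx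
  have harc : arc τ = {v | v ≤ f ∨ D.max' hD < v} := arc_of_max_mem D hD hτ h1
  rw [phi_eq_of_max D hD h0 h1]
  by_cases hfl : f < l
  · rw [if_pos hfl]
    have hsub : flipHigh τ l ⊆ D := flipHigh_subset D hτ (mem_sdiff.1 hlD).1
    have h0' : D.min' hD ∉ flipHigh τ l := by
      rw [mem_flipHigh]
      rintro (heq | ⟨hmem, _⟩)
      · exact absurd (heq ▸ lt_trans h0f hfl) (lt_irrefl _)
      · exact h0 hmem
    have h1' : D.max' hD ∉ flipHigh τ l := by
      rw [mem_flipHigh]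
      rintro (heq | ⟨_, hlt⟩)
      · exact absurd heq hl1.ne'
      · exact absurd hlt (not_lt.2 hl1.le)
    have harcI : arc (flipHigh τ l) = {v | v ≤ f ∨ l < v} := arc_flipHigh hfτ hmin hfl
    have harcI' : arc (D \ flipHigh τ l) = arc D := arc_sdiff_of_neither D hD h0' h1'
    have hincl : arc τ ⊆ arc (flipHigh τ l) := by
      rw [harc, harcI]
      rintro v (hv | hv)
      · exact Or.inl hv
      · exact Or.inr (lt_trans hl1 hv)
    refine ⟨hsub, ?_, ?_⟩
    · apply wtA_eq_one_of
      · exact hitA_mono hincl hhit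
      · rw [harcI]; exact hWU
      · rw [harcI]; exact hWV
      · rw [harcI']; exact hDU
      · rw [harcI']; exact hDV
    · have hne : (flipHigh τ l).Nonempty := ⟨l, mem_flipHigh.2 (Or.inl rfl)⟩
      have hmax' := max'_flipHigh (τ := τ) (l := l) hne
      have hmin' := min'_flipHigh hfτ hmin hfl hne
      rw [psi_of_ne D c hne (by rw [hmin', hmax']; exact hfl.ne),
        if_neg (by rw [hmax']; exact not_lt.2 (le_trans hhf hfl.le)), hmax']
      ext x
      simp only [mem_union, mem_sdiff, mem_flipHigh, mem_singleton, mem_filter]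
      constructor
      · rintro (⟨hx | ⟨hx, _⟩, hne'⟩ | ⟨hxD, hxl⟩)
        · exact absurd hx hne'
        · exact hx
        · by_contra hxτ
          exact absurd (hlmax x (mem_sdiff.2 ⟨hxD, hxτ⟩)) (not_le.2 hxl)
      · intro hx
        have hxl : x ≠ l := fun heq => hlτ (heq ▸ hx)
        rcases lt_or_gt_of_ne hxl with hlt | hgt
        · exact Or.inl ⟨Or.inr ⟨hx, hlt⟩, hxl⟩
        · exact Or.inr ⟨hτ hx, hgt⟩
  · rw [if_neg hfl]
    have hlf : l < f := lt_of_le_of_ne (not_lt.1 hfl) fun heq => hlτ (heq ▸ hfτ)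
    have hsub : ({f} : Finset (Fin (n + 1))) ⊆ D := singleton_subset_iff.2 (hτ hfτ)
    have h0' : D.min' hD ∉ ({f} : Finset (Fin (n + 1))) := by
      rw [mem_singleton]; exact h0f.ne
    have h1' : D.max' hD ∉ ({f} : Finset (Fin (n + 1))) := by
      rw [mem_singleton]; exact hf1.ne'
    have harcI' : arc (D \ {f}) = arc D := arc_sdiff_of_neither D hD h0' h1'
    refine ⟨hsub, ?_, ?_⟩
    · apply wtA_eq_one_of
      · rw [arc_singleton]; exact hitA_univ A
      · rw [arc_singleton]; exact hunivU
      · rw [arc_singleton]; exact hunivV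
      · rw [harcI']; exact hDU
      · rw [harcI']; exact hDV
    · rw [psi_singleton, if_neg (not_lt.2 hhf)]
      ext x
      simp only [mem_filter]
      constructor
      · rintro ⟨hxD, hfx⟩
        by_contra hxτ
        exact absurd (le_trans hfx (hlmax x (mem_sdiff.2 ⟨hxD, hxτ⟩))) (not_le.2 hlf)
      · intro hx
        exact ⟨hτ hx, hmin x hx⟩

/-- `phi` maps every negative colouring to a positive one, and `psi D c` decodes it. -/
lemma phi_specA (hU : IsUpperSet 𝓤) (hV : IsUpperSet 𝓥) {c : Fin (n + 1)} (hcA : c ∈ A)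
    (hc0 : D.min' hD < c) (hc1 : c ≤ D.max' hD) {τ : Finset (Fin (n + 1))}
    (hτ : τ ∈ negSetA D A 𝓤 𝓥) :
    phi D hD τ ∈ posSetA D A 𝓤 𝓥 ∧ psi D c (phi D hD τ) = τ := by
  rw [negSetA, mem_filter, mem_powerset] at hτ
  obtain ⟨hτD, hw⟩ := hτ
  have hnb := not_both_of_negA hD hU hV hτD hw
  have hnn := not_neither_of_negA hD hU hV hτD hw
  by_cases h0 : D.min' hD ∈ τ
  · have h1 : D.max' hD ∉ τ := fun h1 => hnb ⟨h0, h1⟩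
    obtain ⟨hsub, hw', hpsi⟩ := phi_spec_minA hD hU hV hcA hc0 hτD h0 h1 hw
    exact ⟨by rw [posSetA, mem_filter, mem_powerset]; exact ⟨hsub, hw'⟩, hpsi⟩
  · have h1 : D.max' hD ∈ τ := by
      by_contra h1
      exact hnn ⟨h0, h1⟩
    obtain ⟨hsub, hw', hpsi⟩ := phi_spec_maxA hD hU hV hcA hc1 hτD h0 h1 hw
    exact ⟨by rw [posSetA, mem_filter, mem_powerset]; exact ⟨hsub, hw'⟩, hpsi⟩

/-- **The counting core with a hit set**: for a witness cut `c ∈ A` strictly inside the hull of `D`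
and up-sets `𝓤 𝓥`, the antipodal 2-colouring sum over the subsets of `D` is nonnegative. -/
theorem sum_wtA_nonneg (hU : IsUpperSet 𝓤) (hV : IsUpperSet 𝓥) {c : Fin (n + 1)} (hcA : c ∈ A)
    (hc0 : D.min' hD < c) (hc1 : c ≤ D.max' hD) : 0 ≤ ∑ τ ∈ D.powerset, wtA D A 𝓤 𝓥 τ := by
  rw [sum_wtA_eq_card_sub_card, sub_nonneg]
  have hcard : (negSetA D A 𝓤 𝓥).card ≤ (posSetA D A 𝓤 𝓥).card := by
    refine card_le_card_of_injOn (phi D hD) (fun τ hτ => (phi_specA hD hU hV hcA hc0 hc1 hτ).1) ?_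
    intro τ hτ τ' hτ' heq
    have h1 := (phi_specA hD hU hV hcA hc0 hc1 hτ).2
    have h2 := (phi_specA hD hU hV hcA hc0 hc1 hτ').2
    rw [← h1, ← h2, heq]
  exact_mod_cast hcard

end Main

end TCycle

end Summit.Ventures.PercRepro2
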